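import Summits.AnomalousDissipation.AnomalousDissipation.Theorems.TwoAndHalfDTwohalfdNegCondensateRenormalisation
import Literature.Analysis.FluidPDE.PassiveScalarCommutatorSobolev
import Literature.Analysis.FluidPDE.PassiveScalarEnergySobolev
import Literature.Analysis.FluidPDE.PassiveScalarProofs

/-!
# Steady renormalisation (DiPerna–Lions) for `C⁰ ∩ H¹` condensates

Stub `stub_condensateRenormalisationSobolev` of the condensate theorem (crux `TwohalfdNeg`, line
`log-kantorovich-enstrophy-transfer`), the Sobolev upgrade of
`stub_condensateRenormalisation`: if `Θ ∈ L²(T²)` solves the steady transport equation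
`div(Θ V) = h` in distributions, `∫ Θ ⟪V, ∇φ⟫ + ∫ h φ = 0` for every smooth `φ`, with `V`
continuous, weakly divergence free and `∇V ∈ L²` (spectral `eGradNormSq V < ⊤`), and `h` smooth,
then `∫ Θ h = 0`.

Proof (DiPerna–Lions 1989, §II.1, Lemma II.1 and Thm. II.2 with `p = q = 2`): mollify with the
torus kernels `kₙ = Torus.kernel εₙ`, `εₙ → 0`; the regularised equation
`⟪V, ∇Θₙ⟫ = rₙ + h ⋆ kₙ`, `Θₙ = Θ ⋆ kₙ` (`inner_gradient_convolution_eq`, which only uses the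
continuity of `V`) now has a commutator `rₙ → 0` only in `L¹`
(`Torus.tendsto_lintegral_enorm_comm` through the translation modulus
`‖V(· + z) - V‖_{L²} ≤ |z| ‖∇V‖_{L²}`), so we **renormalise**: for the smooth renormaliser
`β_M = Calculus.renorm M` (`β_M'` bounded and `2`-Lipschitz, `β_M'(y) = 2y` for `|y| ≤ M`), weak
incompressibility tested with `β_M ∘ Θₙ` gives `∫ β_M'(Θₙ) (rₙ + h ⋆ kₙ) = 0`; letting `n → ∞`
(`β_M'(Θₙ) → β_M'(Θ)` and `h ⋆ kₙ → h` in `L²`, `|∫ β_M'(Θₙ) rₙ| ≤ C_M ‖rₙ‖_{L¹} → 0`) yields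
`∫ β_M'(Θ) h = 0` for every `M`, and `M → ∞` (dominated convergence, `|β_M'(y)| ≤ 2|y|`) gives
`2 ∫ Θ h = 0`.

## References

* R. J. DiPerna, P.-L. Lions, *Ordinary differential equations, transport theory and Sobolev
  spaces*, Invent. Math. 98 (1989), 511–547, §II.1, Lemma II.1, Thm. II.2.
* L. Ambrosio, G. Crippa, *Continuity equations and ODE flows with non-smooth velocity*,
  Proc. Roy. Soc. Edinburgh 144A (2014), 1191–1244, §4, Thm. 4.6.
-/

namespace Summit.AnomalousDissipation.AnomalousDissipation.Theorems.TwohalfdNeg.Condensate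

open MeasureTheory Filter Topology
open scoped ENNReal NNReal InnerProductSpace
open Literature.Analysis.FunctionSpaces Literature.Analysis.FluidPDE

set_option linter.dupNamespace false

open scoped Convolution
open Literature.Analysis.Calculus

/-! ## The renormaliser `β_M' = renormDeriv M` -/

/-- `β_M'(y) = 2y` for `|y| ≤ M` (the cutoff is `1` on `[-M, M]`). [folklore] -/
theorem sobolev_renormDeriv_eq_two_mul {M y : ℝ} (hy : |y| ≤ M) : renormDeriv M y = 2 * y := by
  have h : Set.EqOn (fun r : ℝ => 2 * (truncCutoff M) r ^ 2) (fun _ => (2 : ℝ))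
      (Set.uIcc (0 : ℝ) y) := by
    intro t ht
    have h1 : (truncCutoff M) t = 1 := by
      refine truncCutoff_eq_one ?_
      rw [Set.mem_uIcc] at ht
      rcases ht with h | h
      · rw [abs_of_nonneg h.1]; exact h.2.trans ((le_abs_self y).trans hy)
      · rw [abs_of_nonpos h.2]; linarith [neg_le_abs y, h.1]
    simp only [h1, one_pow, mul_one]
  rw [renormDeriv, intervalIntegral.integral_congr h, intervalIntegral.integral_const, sub_zero,
    smul_eq_mul, mul_comm]

/-- `β_M'(y) → 2y` as `M → ∞` (eventually equal). [folklore] -/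
theorem sobolev_tendsto_renormDeriv (y : ℝ) :
    Tendsto (fun M : ℕ => renormDeriv M y) atTop (𝓝 (2 * y)) :=
  tendsto_const_nhds.congr' (by
    filter_upwards [tendsto_natCast_atTop_atTop.eventually (eventually_ge_atTop |y|)] with M hM
    exact (sobolev_renormDeriv_eq_two_mul hM).symm)

/-- `β_M'` is `2`-Lipschitz (`β_M'' = 2χ² ≤ 2`). [folklore] -/
theorem sobolev_abs_renormDeriv_sub_le (M a b : ℝ) :
    |renormDeriv M a - renormDeriv M b| ≤ 2 * |a - b| := by
  have hL : LipschitzWith 2 (renormDeriv M) := by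
    refine lipschitzWith_of_nnnorm_deriv_le
      (fun y => (hasDerivAt_renormDeriv M y).differentiableAt) fun y => ?_
    rw [deriv_renormDeriv, ← NNReal.coe_le_coe, coe_nnnorm, Real.norm_eq_abs, NNReal.coe_ofNat,
      abs_of_nonneg (by positivity)]
    have h1 := abs_truncCutoff_le_one M y
    rw [abs_le] at h1
    nlinarith [(truncCutoff M).nonneg (x := y)]
  have := hL.dist_le_mul a b
  rwa [Real.dist_eq, Real.dist_eq, NNReal.coe_ofNat] at this

/-! ## The renormalised regularised equation -/

section Regularised

variable {d : Type*} [Fintype d] {V : UnitAddTorus d → EuclideanSpace ℝ d}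
  {h Θ k : UnitAddTorus d → ℝ}

/-- **Renormalised energy identity for the regularised equation.** If `Θ ∈ L¹` solves
`div(Θ V) = h` in distributions for a continuous weakly divergence-free `V` and `h ∈ L¹`, then
for every smooth kernel `k` and every level `M`, with `A = Θ ⋆ k` and the commutator
`r(x) = ∫ Θ(y) ⟪V x - V y, ∇k(x - y)⟫ dy`:
`∫ β_M'(A) (h ⋆ k) = -∫ β_M'(A) r` (the regularised equation `⟪V, ∇A⟫ = r + h ⋆ k` multiplied by
`β_M'(A)`, and `∫ β_M'(A) ⟪V, ∇A⟫ = ∫ ⟪V, ∇(β_M ∘ A)⟫ = 0`; DiPerna–Lions 1989, §II.3). [folklore] -/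
theorem sobolev_integral_renormDeriv_mul_convolution_eq_neg (hVc : Continuous V)
    (hdiv : Torus.IsWeaklyDivFree V) (hΘ : Integrable Θ volume) (hh : Integrable h volume)
    (hk : Torus.IsSmooth k)
    (hdist : ∀ φ : UnitAddTorus d → ℝ, Torus.IsSmooth φ →
      (∫ x, Θ x * ⟪V x, Torus.gradient φ x⟫_ℝ) + ∫ x, h x * φ x = 0) (M : ℝ) :
    ∫ x, renormDeriv M ((Θ ⋆ k) x) * (h ⋆ k) x =
      -∫ x, renormDeriv M ((Θ ⋆ k) x) *
        ∫ y, Θ y * ⟪V x - V y, Torus.gradient k (x - y)⟫_ℝ := by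
  have hA : Torus.IsSmooth (Θ ⋆ k) := Torus.isSmooth_convolution hΘ hk
  have h0 := Literature.Analysis.FluidPDE.Torus.integral_deriv_comp_mul_inner_gradient_eq_zero
    (v := V) (contDiff_renorm M) hA hdiv
  simp_rw [deriv_renorm, inner_gradient_convolution_eq hVc hΘ hk hdist] at h0
  have hrc : Continuous fun x => ∫ y, Θ y * ⟪V x - V y, Torus.gradient k (x - y)⟫_ℝ :=
    Literature.Analysis.FluidPDE.Torus.continuous_comm hΘ hVc hk
  have hHc : Continuous (h ⋆ k) := Torus.continuous_convolution hh hk.continuous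
  have hFc : Continuous fun x => renormDeriv M ((Θ ⋆ k) x) :=
    (continuous_renormDeriv M).comp hA.continuous
  have i1 : Integrable (fun x => renormDeriv M ((Θ ⋆ k) x) *
      ∫ y, Θ y * ⟪V x - V y, Torus.gradient k (x - y)⟫_ℝ) volume :=
    (hFc.mul hrc).integrable_unitAddTorus
  have i2 : Integrable (fun x => renormDeriv M ((Θ ⋆ k) x) * (h ⋆ k) x) volume :=
    (hFc.mul hHc).integrable_unitAddTorus
  simp_rw [mul_add] at h0
  rw [integral_add i1 i2] at h0
  linarith

end Regularised

/-! ## The two limits -/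

section Limit

variable {d : Type*} [Fintype d]

/-- **Abstract limit step with an `L¹` commutator.** If `∫ Fₙ Hₙ = -∫ Fₙ rₙ` for all `n`, with
`|Fₙ| ≤ C`, `Fₙ → F` and `Hₙ → h` in `L²` and `∫ |rₙ| → 0`, then `∫ F h = 0` (continuity of the
`L²` inner product and `|∫ Fₙ rₙ| ≤ C ‖rₙ‖_{L¹}`). [folklore] -/
theorem sobolev_integral_mul_eq_zero_of_tendsto {F h : UnitAddTorus d → ℝ}
    {Fn H r : ℕ → UnitAddTorus d → ℝ}
    (hF : MemLp F 2 volume) (hh : MemLp h 2 volume) (hFn : ∀ n, MemLp (Fn n) 2 volume)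
    (hH : ∀ n, MemLp (H n) 2 volume) {C : ℝ} (hC : ∀ n x, |Fn n x| ≤ C)
    (hr : ∀ n, AEStronglyMeasurable (r n) volume) (hrfin : ∀ n, ∫⁻ x, ‖r n x‖ₑ < ⊤)
    (hid : ∀ n, ∫ x, Fn n x * H n x = -∫ x, Fn n x * r n x)
    (hFconv : Tendsto (fun n => eLpNorm (Fn n - F) 2 volume) atTop (𝓝 0))
    (hHconv : Tendsto (fun n => eLpNorm (H n - h) 2 volume) atTop (𝓝 0))
    (hrconv : Tendsto (fun n => ∫⁻ x, ‖r n x‖ₑ) atTop (𝓝 0)) :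
    ∫ x, F x * h x = 0 := by
  -- `⟪[f], [g]⟫_{L²} = ∫ f g`
  have inner_toLp_eq_integral : ∀ {f g : UnitAddTorus d → ℝ} (hf : MemLp f 2 volume)
      (hg : MemLp g 2 volume), ⟪hf.toLp f, hg.toLp g⟫_ℝ = ∫ x, f x * g x := by
    intro f g hf hg
    rw [MeasureTheory.L2.inner_def]
    refine integral_congr_ae ?_
    filter_upwards [hf.coeFn_toLp, hg.coeFn_toLp] with x hfx hgx
    rw [hfx, hgx, RCLike.inner_apply, conj_trivial, mul_comm]
  have tF : Tendsto (fun n => (hFn n).toLp (Fn n)) atTop (𝓝 (hF.toLp F)) :=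
    (Lp.tendsto_Lp_iff_tendsto_eLpNorm'' _ hFn _ hF).2 hFconv
  have tH : Tendsto (fun n => (hH n).toLp (H n)) atTop (𝓝 (hh.toLp h)) :=
    (Lp.tendsto_Lp_iff_tendsto_eLpNorm'' _ hH _ hh).2 hHconv
  have lim1 : Tendsto (fun n => ∫ x, Fn n x * H n x) atTop (𝓝 (∫ x, F x * h x)) := by
    have := tF.inner (𝕜 := ℝ) tH
    simpa only [inner_toLp_eq_integral] using this
  have lim2 : Tendsto (fun n => ∫ x, Fn n x * H n x) atTop (𝓝 0) := by
    have ht : Tendsto (fun n => C * (∫⁻ x, ‖r n x‖ₑ).toReal) atTop (𝓝 0) := by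
      have h1 := ((ENNReal.tendsto_toReal ENNReal.zero_ne_top).comp hrconv).const_mul C
      rwa [ENNReal.toReal_zero, mul_zero] at h1
    have h2 : Tendsto (fun n => ∫ x, Fn n x * r n x) atTop (𝓝 0) :=
      squeeze_zero_norm' (Eventually.of_forall fun n => by
        rw [Real.norm_eq_abs]
        exact Literature.Analysis.FluidPDE.Torus.IsWeakScalarTransportOn.abs_integral_mul_le_mul_toReal_lintegral (hC n)
          (hr n) (hrfin n)) ht
    simp_rw [hid]
    simpa using h2.neg
  exact tendsto_nhds_unique lim1 lim2

/-- **Removing the renormalisation.** If `∫ β_M'(Θ) h = 0` for every level `M ∈ ℕ`, with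
`Θ ∈ L¹` and `h` continuous, then `∫ Θ h = 0` (dominated convergence: `β_M'(Θ) → 2Θ` pointwise,
`|β_M'(Θ) h| ≤ 2 |Θ| ‖h‖_∞`). [folklore] -/
theorem sobolev_integral_mul_eq_zero_of_forall_renormDeriv {Θ h : UnitAddTorus d → ℝ}
    (hΘ : Integrable Θ volume) (hh : Continuous h)
    (hM : ∀ M : ℕ, ∫ x, renormDeriv M (Θ x) * h x = 0) : ∫ x, Θ x * h x = 0 := by
  obtain ⟨Ch, hCh⟩ := Torus.exists_forall_norm_le_of_continuous hh
  have hCh0 : 0 ≤ Ch := (norm_nonneg _).trans (hCh 0)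
  have hlim : Tendsto (fun M : ℕ => ∫ x, renormDeriv M (Θ x) * h x) atTop
      (𝓝 (∫ x, 2 * Θ x * h x)) := by
    refine tendsto_integral_of_dominated_convergence (fun x => 2 * ‖Θ x‖ * Ch) (fun M => ?_)
      ((hΘ.norm.const_mul 2).mul_const Ch) (fun M => Eventually.of_forall fun x => ?_)
      (Eventually.of_forall fun x => (sobolev_tendsto_renormDeriv (Θ x)).mul_const (h x))
    · exact ((continuous_renormDeriv M).comp_aestronglyMeasurable hΘ.aestronglyMeasurable).mul
        hh.aestronglyMeasurable
    · rw [norm_mul]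
      refine mul_le_mul ?_ (hCh x) (norm_nonneg _) (by positivity)
      rw [Real.norm_eq_abs, Real.norm_eq_abs]
      exact abs_renormDeriv_le _ _
  have h0 : Tendsto (fun M : ℕ => ∫ x, renormDeriv M (Θ x) * h x) atTop (𝓝 0) := by
    simp_rw [hM]
    exact tendsto_const_nhds
  have h2 := tendsto_nhds_unique hlim h0
  have e : ∫ x, 2 * Θ x * h x = 2 * ∫ x, Θ x * h x := by
    rw [← MeasureTheory.integral_const_mul]
    exact integral_congr_ae (Eventually.of_forall fun x => by ring)
  rw [e] at h2
  linarith

end Limit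

/-! ## The stub -/

/-- **Stub G' — steady renormalisation for `H¹ ∩ C⁰` fields (DiPerna–Lions, Sobolev case).** If
`Θ ∈ L²(T²)` solves `div(Θ V) = h` in distributions for a continuous, weakly divergence-free `V` with
`∇V ∈ L²` (spectral `eGradNormSq V < ⊤`) and a smooth `h`, then `∫ Θ h = 0`.
[cite: DiPernaLions1989, §II.1, Lemma II.1 and Thm. II.2] -/
theorem stub_condensateRenormalisationSobolev :
    ∀ (V : UnitAddTorus (Fin 2) → EuclideanSpace ℝ (Fin 2)) (h Θ : UnitAddTorus (Fin 2) → ℝ),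
      Continuous V → Torus.IsWeaklyDivFree V → Torus.eGradNormSq V < ⊤ → Torus.IsSmooth h →
      MemLp Θ 2 volume →
      (∀ φ : UnitAddTorus (Fin 2) → ℝ, Torus.IsSmooth φ →
        (∫ x, Θ x * inner ℝ (V x) (Torus.gradient φ x)) + ∫ x, h x * φ x = 0) →
      ∫ x, Θ x * h x = 0 := by
  intro V h Θ hVc hWdiv hgrad hh hΘ hdist
  have hΘi : Integrable Θ volume := hΘ.integrable one_le_two
  have hhi : Integrable h volume := hh.integrable
  have hVi : Integrable V volume := hVc.integrable_unitAddTorus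
  have hV2 : MemLp V 2 volume :=
    hVc.memLp_of_hasCompactSupport (HasCompactSupport.of_compactSpace _)
  obtain ⟨CV, hCV⟩ := Torus.exists_forall_norm_le_of_continuous hVc
  have hVΘ : Integrable (fun y => ‖V y‖ * Θ y) volume :=
    hΘi.bdd_mul hVc.norm.aestronglyMeasurable
      (Eventually.of_forall fun y => by rw [norm_norm]; exact hCV y)
  obtain ⟨hε, hε', hε0⟩ := Literature.Analysis.FluidPDE.Torus.molRadius_spec
  have hkS : ∀ n : ℕ, Torus.IsSmooth (Torus.kernel (d := Fin 2) (1 / (4 * ((n : ℝ) + 1)))) :=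
    fun n => Torus.isSmooth_kernel (hε n) (hε' n)
  -- the commutators `rₙ → 0` in `L¹`
  have hB : Torus.eGradNormSq V ^ (1 / 2 : ℝ) ≠ ⊤ :=
    ENNReal.rpow_ne_top_of_nonneg (by norm_num) hgrad.ne
  have hrconv := Literature.Analysis.FluidPDE.Torus.tendsto_lintegral_enorm_comm hΘ hVi hVΘ hWdiv
    hB hε hε' hε0 (fun n z hz =>
      Literature.Analysis.FluidPDE.Torus.IsWeakScalarTransportOn.eLpNorm_sub_translate_le_of_gradient_kernel_ne_zero hV2
        (hε n) (hε' n) hz)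
  -- `Θ ⋆ kₙ → Θ` and `h ⋆ kₙ → h` in `L²`
  have hAconv := Torus.tendsto_eLpNorm_convolution_sub_self hΘ
    (fun n y => Torus.kernel_nonneg (hε n).le y) (fun n => Torus.integral_kernel (hε n) (hε' n))
    (fun n => Torus.support_kernel_subset (hε n))
    (fun n => Torus.continuous_kernel (hε n) (hε' n)) hε0
  have hHconv := Torus.tendsto_eLpNorm_convolution_sub_self (hh.memLp 2)
    (fun n y => Torus.kernel_nonneg (hε n).le y) (fun n => Torus.integral_kernel (hε n) (hε' n))
    (fun n => Torus.support_kernel_subset (hε n))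
    (fun n => Torus.continuous_kernel (hε n) (hε' n)) hε0
  -- renormalise at level `M`, then let `M → ∞`
  refine sobolev_integral_mul_eq_zero_of_forall_renormDeriv hΘi hh.continuous fun M => ?_
  have hmF : ∀ {f : UnitAddTorus (Fin 2) → ℝ}, AEStronglyMeasurable f volume →
      MemLp (fun x => renormDeriv M (f x)) 2 volume := fun hf =>
    (memLp_top_of_bound ((continuous_renormDeriv _).comp_aestronglyMeasurable hf)
      (4 * ((truncCutoff (M : ℝ)).rIn + 1)) (Eventually.of_forall fun x => by
        rw [Real.norm_eq_abs]
        exact abs_renormDeriv_le_const _ _)).mono_exponent le_top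
  refine sobolev_integral_mul_eq_zero_of_tendsto
    (F := fun x => renormDeriv M (Θ x))
    (Fn := fun n x => renormDeriv M ((Θ ⋆ Torus.kernel (1 / (4 * ((n : ℝ) + 1)))) x))
    (H := fun n => h ⋆ Torus.kernel (1 / (4 * ((n : ℝ) + 1))))
    (r := fun n x => ∫ y, Θ y * ⟪V x - V y,
      Torus.gradient (Torus.kernel (1 / (4 * ((n : ℝ) + 1)))) (x - y)⟫_ℝ)
    (hmF hΘ.aestronglyMeasurable) (hh.memLp 2)
    (fun n => hmF (Torus.isSmooth_convolution hΘi (hkS n)).continuous.aestronglyMeasurable)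
    (fun n => (Torus.isSmooth_convolution hhi (hkS n)).memLp 2)
    (fun n x => abs_renormDeriv_le_const _ _)
    (fun n => (Literature.Analysis.FluidPDE.Torus.continuous_comm hΘi hVc
      (hkS n)).aestronglyMeasurable)
    (fun n => ((Literature.Analysis.FluidPDE.Torus.continuous_comm hΘi hVc
      (hkS n)).integrable_unitAddTorus).2)
    (fun n => sobolev_integral_renormDeriv_mul_convolution_eq_neg hVc hWdiv hΘi hhi (hkS n)
      hdist M)
    ?_ hHconv hrconv
  -- `β_M'(Θ ⋆ kₙ) → β_M'(Θ)` in `L²` (`β_M'` is `2`-Lipschitz)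
  have hle : ∀ n : ℕ, eLpNorm ((fun x => renormDeriv M
      ((Θ ⋆ Torus.kernel (1 / (4 * ((n : ℝ) + 1)))) x)) - fun x => renormDeriv M (Θ x)) 2 volume ≤
      ENNReal.ofReal 2 * eLpNorm (Θ ⋆ Torus.kernel (1 / (4 * ((n : ℝ) + 1))) - Θ) 2 volume :=
    fun n => eLpNorm_le_mul_eLpNorm_of_ae_le_mul (Eventually.of_forall fun x => by
      rw [Pi.sub_apply, Pi.sub_apply, Real.norm_eq_abs, Real.norm_eq_abs]
      exact sobolev_abs_renormDeriv_sub_le _ _ _) 2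
  refine tendsto_of_tendsto_of_tendsto_of_le_of_le tendsto_const_nhds ?_ (fun _ => zero_le) hle
  have h2 := ENNReal.Tendsto.const_mul hAconv (Or.inr (ENNReal.ofReal_ne_top (r := 2)))
  rwa [mul_zero] at h2

end Summit.AnomalousDissipation.AnomalousDissipation.Theorems.TwohalfdNeg.Condensate
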